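import Summits.QuantumAdvantage.QuantumAdvantage.Theorems.AnchorDialShellM

/-!
# AnchorDial — part 26 «PlaceM» (cell decomp-qadv, seat lens-2, generation 15; supports item 26531 `ExactnessDial.PolyLossOddU3`)

§I of the g15 node «GaugeDial»: placement and constants.  `sum_shift_le`, `sum_inst_le` (instability mass summed
over offsets), `card_straddle_le`, `sum_straddle_le` (anchors straddling the flip region, summed over offsets),
`equiF_gen` (equidistribution `EquiF N F D' (siteF t L F) 2^{N-e}` from the chain, general junk exponent `e`,
`K = 2^{e+2}`), `hK_gen`, and the arithmetic `choose_two_add_four`, `choose_two_grow`,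
`hcore : 4·6^m(1+(4m+8)+C(4m+8,2)) ≤ 2^{4m+8}`.  Namespace `…Theorems.AnchorDial`; imports part 25.  Verbatim from the node file; no `sorry`, no `native_decide`, no instances/notation; lint-clean without the unusedVariables switch.
-/

set_option linter.dupNamespace false

/-! ## §I  Placement in one region, general-exponent equidistribution, and the constants -/

noncomputable section

open scoped Classical

namespace Summit.QuantumAdvantage.QuantumAdvantage.Theorems.AnchorDial

open Finset
open Literature.Computability.QuantumComplexity Literature.Computability.QuantumComplexity.RingHLF
open Literature.Computability.MetaComplexity Literature.Computability.MetaComplexity.Smolensky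
open Summit.QuantumAdvantage.AdviceFreeQNC0
open Summit.QuantumAdvantage.QuantumAdvantage.Theorems.HolonomyDial (gCond selP selP_mem selP_apply indP indP_mem indP_apply)

variable {N : ℕ}

section PlaceM

variable {F m : ℕ}

/-- shifted partial sums are dominated by the full sum. -/
theorem sum_shift_le (U : ℕ → ℕ) (Lt d N' : ℕ) (h : Lt + d ≤ N') :
    ∑ t ∈ range Lt, U (t + d) ≤ ∑ a ∈ range N', U a := by
  have h1 : ∑ t ∈ range Lt, U (t + d) = ∑ a ∈ (range Lt).map (addRightEmbedding d), U a := by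
    rw [Finset.sum_map]; rfl
  rw [h1]
  refine Finset.sum_le_sum_of_subset fun a ha => ?_
  rw [Finset.mem_map] at ha
  obtain ⟨t, ht, rfl⟩ := ha
  rw [mem_range] at ht ⊢
  simp only [addRightEmbedding_apply]
  omega

/-- (STAB) placement: summing the site instabilities over the offsets `t < Lt` counts each ring position at most
`F` times per family. -/
theorem sum_inst_le (U : Fin m → ℕ → ℕ) (Lt L N' : ℕ) (h : Lt + F * L ≤ N') :
    ∑ t ∈ range Lt, ∑ j, ∑ i : Fin F, U j (siteF t L F i) ≤ ∑ j : Fin m, ∑ _i : Fin F, ∑ a ∈ range N', U j a := by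
  rw [Finset.sum_comm]
  refine sum_le_sum fun j _ => ?_
  rw [Finset.sum_comm]
  refine sum_le_sum fun i _ => ?_
  unfold siteF
  refine sum_shift_le (U j) Lt ((i.val + 1) * L) N' ?_
  have h1 : (i.val + 1) * L ≤ F * L := Nat.mul_le_mul_right L (by omega)
  omega

/-- an anchor straddling the flip region `[t+L, t+FL]` (with `r ≤ L`) sits at `t + d`, `d ≤ FL`. -/
theorem card_straddle_le (A : Fin N → CubeFn (ZMod 3) N) (t L r : ℕ) (hrL : r ≤ L) :
    (univ.filter fun x : Fin N → Bool => OddZeros x ∧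
      ∃ k, anc A x = {k} ∧ ¬ ((∀ i : Fin F, k.val + r < siteF t L F i) ∨ (∀ i : Fin F, siteF t L F i + 1 ≤ k.val))).card
      ≤ ∑ d ∈ range (F * L + 1), Hc A (t + d) := by
  unfold Hc
  refine le_trans (card_le_card fun x hx => ?_) card_biUnion_le
  rw [mem_filter] at hx
  obtain ⟨_, hodd, k, hk, hreg⟩ := hx
  rw [not_or, not_forall, not_forall] at hreg
  obtain ⟨⟨i, hi⟩, ⟨i', hi'⟩⟩ := hreg
  simp only [siteF, not_lt, not_le] at hi hi'
  have h1 : (i.val + 1) * L ≥ L := Nat.le_mul_of_pos_left L (by omega)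
  have h2 : (i'.val + 1) * L ≤ F * L := Nat.mul_le_mul_right L (by omega)
  rw [mem_biUnion]
  refine ⟨k.val - t, mem_range.2 (by omega), mem_filter.2 ⟨mem_univ _, hodd, k, hk, by omega⟩⟩

/-- summing the anchor histogram window over the offsets. -/
theorem sum_straddle_le (A : Fin N → CubeFn (ZMod 3) N) (Lt R : ℕ) (h : Lt + R ≤ N + 1) :
    ∑ t ∈ range Lt, ∑ d ∈ range R, Hc A (t + d) ≤ R * (univ.filter fun x : Fin N → Bool => OddZeros x).card := by
  rw [Finset.sum_comm]
  calc ∑ d ∈ range R, ∑ t ∈ range Lt, Hc A (t + d)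
      ≤ ∑ d ∈ range R, (univ.filter fun x : Fin N → Bool => OddZeros x).card :=
        sum_le_sum fun d hd => (sum_shift_le (Hc A) Lt d N (by rw [mem_range] at hd; omega)).trans (sum_Hc_le A)
    _ = R * (univ.filter fun x : Fin N → Bool => OddZeros x).card := by rw [sum_const, card_range, smul_eq_mul]

/-- general-exponent `EquiF` at admissible sites: `η = 2^(N-e)` for the degree budget `2^(e+2)·2D'·C(L,L/2) ≤ 2^L`. -/
theorem equiF_gen {t L F D' e : ℕ} (hL : Odd L) (hL3 : 3 ≤ L) (hfit : t + 1 + (F + 1) * L ≤ N) (he : e ≤ N)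
    (hK : 2 ^ (e + 2) * ((D' + D') * L.choose (L / 2)) ≤ 2 ^ L) :
    EquiF N F D' (siteF t L F) (2 ^ (N - e)) := by
  intro E hE z
  have p11 := pieceF_le hL hL3 hfit hK hE z 1 1 (Or.inl rfl) (Or.inl rfl)
  have p1m := pieceF_le hL hL3 hfit hK hE z 1 (-1) (Or.inl rfl) (Or.inr rfl)
  have pm1 := pieceF_le hL hL3 hfit hK hE z (-1) 1 (Or.inr rfl) (Or.inl rfl)
  have pmm := pieceF_le hL hL3 hfit hK hE z (-1) (-1) (Or.inr rfl) (Or.inr rfl)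
  set q := t + 1 + (F + 1) * L with hq
  have hS := split_sign (N := N) (fun x => OddZeros x ∧ E x = 1 ∧ zvecF (siteF t L F) x = z) 0 (t + 1)
  have hS1 := split_sign (N := N) (fun x => (OddZeros x ∧ E x = 1 ∧ zvecF (siteF t L F) x = z) ∧
      bsgn 0 (t + 1) x = 1) q (N - q)
  have hSm := split_sign (N := N) (fun x => (OddZeros x ∧ E x = 1 ∧ zvecF (siteF t L F) x = z) ∧
      bsgn 0 (t + 1) x = -1) q (N - q)
  have hY := split_sign (N := N) (fun x => E x = 1) 0 (t + 1)
  have hY1 := split_sign (N := N) (fun x => E x = 1 ∧ bsgn 0 (t + 1) x = 1) q (N - q)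
  have hYm := split_sign (N := N) (fun x => E x = 1 ∧ bsgn 0 (t + 1) x = -1) q (N - q)
  have hpow : 2 ^ N = 2 ^ e * 2 ^ (N - e) := by rw [← pow_add]; congr 1; omega
  set S := (univ.filter fun x : Fin N → Bool => OddZeros x ∧ E x = 1 ∧ zvecF (siteF t L F) x = z).card
  set Y := (univ.filter fun x : Fin N → Bool => E x = 1).card
  set S1 := (univ.filter fun x => (OddZeros x ∧ E x = 1 ∧ zvecF (siteF t L F) x = z) ∧ bsgn 0 (t + 1) x = 1).card
  set Sm := (univ.filter fun x => (OddZeros x ∧ E x = 1 ∧ zvecF (siteF t L F) x = z) ∧ bsgn 0 (t + 1) x = -1).card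
  set S11 := (univ.filter fun x => ((OddZeros x ∧ E x = 1 ∧ zvecF (siteF t L F) x = z) ∧ bsgn 0 (t + 1) x = 1) ∧
    bsgn q (N - q) x = 1).card
  set S1m := (univ.filter fun x => ((OddZeros x ∧ E x = 1 ∧ zvecF (siteF t L F) x = z) ∧ bsgn 0 (t + 1) x = 1) ∧
    bsgn q (N - q) x = -1).card
  set Sm1 := (univ.filter fun x => ((OddZeros x ∧ E x = 1 ∧ zvecF (siteF t L F) x = z) ∧ bsgn 0 (t + 1) x = -1) ∧
    bsgn q (N - q) x = 1).card
  set Smm := (univ.filter fun x => ((OddZeros x ∧ E x = 1 ∧ zvecF (siteF t L F) x = z) ∧ bsgn 0 (t + 1) x = -1) ∧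
    bsgn q (N - q) x = -1).card
  set Y1 := (univ.filter fun x => E x = 1 ∧ bsgn 0 (t + 1) x = 1).card
  set Ym := (univ.filter fun x => E x = 1 ∧ bsgn 0 (t + 1) x = -1).card
  set Y11 := (univ.filter fun x => (E x = 1 ∧ bsgn 0 (t + 1) x = 1) ∧ bsgn q (N - q) x = 1).card
  set Y1m := (univ.filter fun x => (E x = 1 ∧ bsgn 0 (t + 1) x = 1) ∧ bsgn q (N - q) x = -1).card
  set Ym1 := (univ.filter fun x => (E x = 1 ∧ bsgn 0 (t + 1) x = -1) ∧ bsgn q (N - q) x = 1).card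
  set Ymm := (univ.filter fun x => (E x = 1 ∧ bsgn 0 (t + 1) x = -1) ∧ bsgn q (N - q) x = -1).card
  set K : ℕ := 2 ^ (e + 2) with hKdef
  set W : ℕ := 2 ^ (F + 1) with hW
  have hSsum : K * (W * S) = K * (W * S11) + K * (W * S1m) + K * (W * Sm1) + K * (W * Smm) := by
    rw [hS, hS1, hSm]; ring
  have hYsum : K * Y = K * Y11 + K * Y1m + K * Ym1 + K * Ymm := by rw [hY, hY1, hYm]; ring
  have hW1 : 1 ≤ W := Nat.one_le_two_pow
  have herr : 4 * ((W - 1) * 2 ^ N) ≤ K * (W * 2 ^ (N - e)) := by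
    have h1 : (W - 1) * 2 ^ N ≤ W * 2 ^ N := Nat.mul_le_mul_right _ (Nat.sub_le _ _)
    have h2 : K * (W * 2 ^ (N - e)) = 4 * (W * 2 ^ N) := by rw [hpow, hKdef, pow_add]; ring
    rw [h2]; exact Nat.mul_le_mul_left 4 h1
  have htot : K * (W * S) ≤ K * Y + K * (W * 2 ^ (N - e)) := by
    rw [hSsum, hYsum]; omega
  rw [← Nat.mul_add] at htot
  exact Nat.le_of_mul_le_mul_left htot (by positivity)

/-- the degree budget from a square-root bound (general constant). -/
theorem hK_gen {L Kc D' : ℕ} (hL : Odd L) (hD : (Kc * (D' + D')) ^ 2 ≤ L) :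
    Kc * ((D' + D') * L.choose (L / 2)) ≤ 2 ^ L := by
  have hc := choose_half_sq_mul_le hL
  have h4 : (2 ^ L) * (2 ^ L) = 4 ^ L := by rw [← pow_two, ← pow_mul, mul_comm, pow_mul]; norm_num
  have key : (Kc * ((D' + D') * L.choose (L / 2))) * (Kc * ((D' + D') * L.choose (L / 2))) ≤ (2 ^ L) * (2 ^ L) := by
    calc (Kc * ((D' + D') * L.choose (L / 2))) * (Kc * ((D' + D') * L.choose (L / 2)))
        = (Kc * (D' + D')) ^ 2 * (L.choose (L / 2)) ^ 2 := by ring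
      _ ≤ L * (L.choose (L / 2)) ^ 2 := Nat.mul_le_mul_right _ hD
      _ = (L.choose (L / 2)) ^ 2 * L := by ring
      _ ≤ 4 ^ L := hc
      _ = (2 ^ L) * (2 ^ L) := h4.symm
  exact Nat.mul_self_le_mul_self_iff.1 key

/-- `C(F+4, 2) = C(F, 2) + 4F + 6`. -/
theorem choose_two_add_four (F : ℕ) : (F + 4).choose 2 = F.choose 2 + 4 * F + 6 := by
  have h : ∀ n, (n + 1).choose 2 = n + n.choose 2 := fun n => by
    rw [Nat.choose_succ_succ, Nat.choose_one_right]
  rw [show F + 4 = (F + 3) + 1 by rfl, h, show F + 3 = (F + 2) + 1 by rfl, h, show F + 2 = (F + 1) + 1 by rfl, h, h]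
  omega

/-- AnchorDialPlaceM helper `choose_two_grow` (decomp-qadv land package; see the module docstring). -/
theorem choose_two_grow (m : ℕ) : 14 * (4 * m + 8) + 50 ≤ 10 * (4 * m + 8).choose 2 := by
  induction m with
  | zero => decide
  | succ m ih =>
    rw [show 4 * (m + 1) + 8 = (4 * m + 8) + 4 by ring, choose_two_add_four]
    omega

/-- **the core numerics at `F = 4m + 8` flips**: `8·6^m·(1+F+C(F,2)) ≤ 2^{F+1}` (room for a loss `≥ 2^{-F-2}`). -/
theorem hcore (m : ℕ) : 4 * (6 ^ m * (1 + (4 * m + 8) + (4 * m + 8).choose 2)) ≤ 2 ^ (4 * m + 8) := by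
  induction m with
  | zero => decide
  | succ m ih =>
    have hg := choose_two_grow m
    rw [show 4 * (m + 1) + 8 = (4 * m + 8) + 4 by ring, choose_two_add_four, pow_succ, pow_add]
    set F := 4 * m + 8
    set q := F.choose 2
    have h1 : 6 * (1 + (F + 4) + (q + 4 * F + 6)) ≤ 16 * (1 + F + q) := by omega
    calc 4 * (6 ^ m * 6 * (1 + (F + 4) + (q + 4 * F + 6)))
        = (4 * (6 ^ m * (1 + F + q))) * (6 * (1 + (F + 4) + (q + 4 * F + 6))) / (1 + F + q) := by
          rw [show (4 * (6 ^ m * (1 + F + q))) * (6 * (1 + (F + 4) + (q + 4 * F + 6)))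
              = (4 * (6 ^ m * 6 * (1 + (F + 4) + (q + 4 * F + 6)))) * (1 + F + q) by ring,
            Nat.mul_div_cancel _ (by omega)]
      _ ≤ (2 ^ F) * (16 * (1 + F + q)) / (1 + F + q) :=
          Nat.div_le_div_right (Nat.mul_le_mul ih h1)
      _ = 2 ^ F * 2 ^ 4 := by
          rw [show (2 ^ F) * (16 * (1 + F + q)) = (2 ^ F * 2 ^ 4) * (1 + F + q) by ring,
            Nat.mul_div_cancel _ (by omega)]

end PlaceM

end Summit.QuantumAdvantage.QuantumAdvantage.Theorems.AnchorDial

end
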